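/-
Copyright (c) 2026 the pub-hodgecm-mathlib formalisation cell (harness21).  Prover seat hodgecm-mathlib-F0P2-p08 (g2), Track B «K2-LIT»,
#184♮ = hLiu418 = `stmt-HodgeConjecture-24832`; socket #41 `sig_K2LiuSiegelEisensteinContinuation`, KIND W, (x-a) STAGE «LOCAL», first letter: the global
Whittaker integrability `hG` of ★ `K2LiuSiegelEisensteinKindWEulerLetters.exists_kindW_eulerLetters_of_letters` ∕ ★ `KindWLetters` §3–§4 DISCHARGED by ★ O41.3.
THEOREMS ONLY (no `def`, no `instance`, no notation, no named-fact hypothesis, no `sorry`).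
-/
import Summits.HodgeConjecture.HodgeConjecture.Theorems.K2LiuIntertwiningConverges                  -- ★ O41.3 `integrable_weylDelta_mul`
import Summits.HodgeConjecture.HodgeConjecture.Theorems.K2LiuSiegelUnipotentCharacters               -- ★ `continuous_unipDeltaChar_coe`
import Summits.HodgeConjecture.HodgeConjecture.Theorems.K2LiuSiegelEisensteinWhittakerFactorLetters  -- ★ frame of the TOP's KIND-W block (`skewMatrices`, `gramR`)
import HarnessLib

/-!
# Crux `HLiu418`, socket #41, KIND W — `K2LiuSiegelEisensteinKindWGlobalIntegrable`: THE GLOBAL WHITTAKER INTEGRAND `u ↦ conj ψ_S(u) · f_s(w_Δ u h)` IS `νN`-INTEGRABLE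
# ON `{n∕2 < re s}` (the letter `hG` of ★ (x-a) `KindWLetters` §3–§4 ∕ `KindWEulerLetters`, paid by ★ O41.3)

Cell `hodgecm-mathlib`, crux item hLiu418 = `stmt-HodgeConjecture-24832`, route of record `HCCMUnconditional`; squad K2 ∕ K2Liu, road `K2_Liu`, socket #41; KIND W
(x-a) (F0P2-p08 lineage).  ★ (x-a) §3 `whittakerDelta_eq_kindWPart_mul`, §4 `whittakerDelta_eq_sum_mul_prod_mul` and the ∃-head ★ `exists_kindW_eulerLetters_of_letters`
carry the integrability of the global Whittaker integrand BY VALUE (`hG`).  It is ★ O41.3 `K2LiuIntertwiningConverges.integrable_weylDelta_mul` (the Siegel intertwining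
integrand `u ↦ f(w_Δ u h)` is Haar-integrable on `N_Δ(𝔸)` for a continuous Siegel section `f ∈ I_Δ(s,χ)`, `χ` unitary, `n∕2 < re s`) times the unit-modulus continuous
character `conj ψ_S` (★ `continuous_unipDeltaChar_coe`; Mathlib `Integrable.bdd_mul`).  Lane `--supports stmt-HodgeConjecture-24832` (count-neutral helper):
* §1 `integrable_conj_unipDeltaChar_mul` — ONE continuous Siegel section, any index `S ∈ M_n(L)`.
* §2 **`hG_of_sections`** — the letter `hG` of ★ `exists_kindW_eulerLetters_of_letters` VERBATIM (family `f`, skew index `S`, `n∕2 < re s`, `det ↑S ≠ 0` unused) from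
  `∀ s, IsSiegelDeltaSection χ s (f s)` + `∀ s, Continuous (f s)`; **`hG_of_isStandardSectionFamily`** — the same at the socket's currency `IsStandardSectionFamily 𝒦 χ f` + `hcont`.
HONEST LABEL.  Count-neutral helper; it retires nothing by itself: `HC_CM` is proved only modulo the 7 printed citations (2 remaining named inputs:
hLiu418 = `stmt-HodgeConjecture-24832`, h413 = `stmt-HodgeConjecture-24833`) until rung 0 closes.

## References
* [MoeglinWaldspurger1995] C. Mœglin, J.-L. Waldspurger, *Spectral Decomposition and Eisenstein Series* (1995): II.1.6–II.1.7 (absolute convergence of intertwining integrals).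
* [Shimura1997] G. Shimura, CBMS 93 (1997): §18.1 (18.4) (the unitary character `ψ_S` on `N_Δ(𝔸)`).
-/

set_option autoImplicit false
-- the mandated namespace repeats the single-problem summit's segment (`HodgeConjecture.HodgeConjecture`)
set_option linter.dupNamespace false

noncomputable section

open scoped Matrix ENNReal NNReal Topology ComplexConjugate
open NumberField IsDedekindDomain MeasureTheory Measure Filter Set

namespace Summit.HodgeConjecture.HodgeConjecture.Cruxes.HLiu418.K2LiuSiegelEisensteinKindWGlobalIntegrable

open Literature.NumberTheory.Automorphic Literature.NumberTheory.GaloisRepresentations Literature.NumberTheory.LFunctions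
open Literature.NumberTheory.GelbartRogawski1991 Literature.NumberTheory.GelbartRogawski1991.GRConstruction
open Literature.NumberTheory.K2Lit.SiegelDoubled
open Summit.HodgeConjecture.HodgeConjecture.Cruxes.HLiu418.K2LiuSiegelUnipotentFourierDefs
open Summit.HodgeConjecture.HodgeConjecture.Cruxes.HLiu418.K2LiuSiegelUnipotentCharacters (continuous_unipDeltaChar_coe)
open Summit.HodgeConjecture.HodgeConjecture.Cruxes.HLiu418.K2LiuIntertwiningConverges (integrable_weylDelta_mul)

variable (L : Type) [Field L] [NumberField L] [IsCMField L]
variable {N M n : ℕ} (e : Fin N × Fin M ≃ Fin n)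
  (dV : Fin N → L) (hdV : ∀ i, IsCMField.complexConj L (dV i) = dV i)
  (dW : Fin M → L) (hdW : ∀ i, IsCMField.complexConj L (dW i) = dW i)
  [MeasurableSpace ↥(unipDelta L e dV hdV dW hdW)] [BorelSpace ↥(unipDelta L e dV hdV dW hdW)]

/-! ## §1 One continuous Siegel section -/

/-- **`u ↦ conj ψ_S(u) · f(w_Δ u h)` IS `νN`-INTEGRABLE** for a continuous Siegel section `f ∈ I_Δ(s,χ)` (`χ` unitary, `n∕2 < re s`, `dV, dW ≠ 0`), any Haar measure `νN`
on `N_Δ(𝔸)`, any index `S` and any `h`: ★ O41.3 `integrable_weylDelta_mul` × the unit-modulus continuous factor `conj ψ_S`.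
[cite: MoeglinWaldspurger1995, II.1.6] [cite: Shimura1997, §18.1 (18.4)] -/
theorem integrable_conj_unipDeltaChar_mul (hdV0 : ∀ i, dV i ≠ 0) (hdW0 : ∀ i, dW i ≠ 0)
    {χ : HeckeCharacter L} (hχ : χ.IsUnitary) {s : ℂ} (hs : (n : ℝ) / 2 < s.re)
    {f : HA L e dV hdV dW hdW → ℂ} (hf : IsSiegelDeltaSection L e dV hdV dW hdW χ s f) (hfc : Continuous f)
    (νN : Measure ↥(unipDelta L e dV hdV dW hdW)) [νN.IsHaarMeasure] (S : Matrix (Fin n) (Fin n) L) (h : HA L e dV hdV dW hdW) :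
    Integrable (fun u : ↥(unipDelta L e dV hdV dW hdW) =>
      conj (unipDeltaChar L e dV hdV dW hdW S (u : HA L e dV hdV dW hdW) : ℂ) * f (weylDelta L e dV hdV dW hdW * (u : HA L e dV hdV dW hdW) * h)) νN := by
  refine (integrable_weylDelta_mul L e dV hdV dW hdW hdV0 hdW0 hχ hs hf hfc νN h).bdd_mul (c := 1)
    (Complex.continuous_conj.comp (continuous_unipDeltaChar_coe L e dV hdV dW hdW S)).aestronglyMeasurable (ae_of_all _ fun u => ?_)
  rw [Complex.norm_conj, Circle.norm_coe]

/-! ## §2 The letter `hG` of the KIND-W ∃-head, verbatim -/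

/-- **THE LETTER `hG` OF ★ `exists_kindW_eulerLetters_of_letters`, PAID** for a family of continuous Siegel sections `f_s ∈ I_Δ(s,χ)`: for every skew index `S`, every `s`
with `n∕2 < re s` and every `h` (the hypothesis `det ↑S ≠ 0` is not needed). [cite: MoeglinWaldspurger1995, II.1.6] [cite: Shimura1997, §18.1 (18.4)] -/
theorem hG_of_sections (hdV0 : ∀ i, dV i ≠ 0) (hdW0 : ∀ i, dW i ≠ 0)
    {χ : HeckeCharacter L} (hχ : χ.IsUnitary) {f : ℂ → HA L e dV hdV dW hdW → ℂ}
    (hf : ∀ s : ℂ, IsSiegelDeltaSection L e dV hdV dW hdW χ s (f s)) (hfc : ∀ s : ℂ, Continuous (f s))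
    (νN : Measure ↥(unipDelta L e dV hdV dW hdW)) [νN.IsHaarMeasure] :
    ∀ (S : skewMatrices ((IsCMField.complexConj L : L ≃ₐ[Fp L] L) : L →+* L) ((gramR L e dV hdV dW hdW).map (algebraMap (Fp L) L))) (s : ℂ)
      (h : HA L e dV hdV dW hdW), (n : ℝ) / 2 < s.re → (S : Matrix (Fin n) (Fin n) L).det ≠ 0 →
      Integrable (fun u : ↥(unipDelta L e dV hdV dW hdW) =>
        conj (unipDeltaChar L e dV hdV dW hdW (S : Matrix (Fin n) (Fin n) L) (u : HA L e dV hdV dW hdW) : ℂ) *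
          f s (weylDelta L e dV hdV dW hdW * (u : HA L e dV hdV dW hdW) * h)) νN :=
  fun S s h hs _ => integrable_conj_unipDeltaChar_mul L e dV hdV dW hdW hdV0 hdW0 hχ hs (hf s) (hfc s) νN (S : Matrix (Fin n) (Fin n) L) h

/-- **THE LETTER `hG` AT THE SOCKET'S CURRENCY**: a STANDARD family (`IsStandardSectionFamily 𝒦 χ f`) of continuous sections (`hcont`), `χ` unitary.
[cite: MoeglinWaldspurger1995, II.1.6] [cite: Shimura1997, §18.1 (18.4)] -/
theorem hG_of_isStandardSectionFamily (hdV0 : ∀ i, dV i ≠ 0) (hdW0 : ∀ i, dW i ≠ 0)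
    {χ : HeckeCharacter L} (hχ : χ.IsUnitary) (𝒦 : IwasawaDatum L e dV hdV dW hdW) {f : ℂ → HA L e dV hdV dW hdW → ℂ}
    (hstd : IsStandardSectionFamily 𝒦 χ f) (hcont : ∀ s : ℂ, Continuous (f s))
    (νN : Measure ↥(unipDelta L e dV hdV dW hdW)) [νN.IsHaarMeasure] :
    ∀ (S : skewMatrices ((IsCMField.complexConj L : L ≃ₐ[Fp L] L) : L →+* L) ((gramR L e dV hdV dW hdW).map (algebraMap (Fp L) L))) (s : ℂ)
      (h : HA L e dV hdV dW hdW), (n : ℝ) / 2 < s.re → (S : Matrix (Fin n) (Fin n) L).det ≠ 0 →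
      Integrable (fun u : ↥(unipDelta L e dV hdV dW hdW) =>
        conj (unipDeltaChar L e dV hdV dW hdW (S : Matrix (Fin n) (Fin n) L) (u : HA L e dV hdV dW hdW) : ℂ) *
          f s (weylDelta L e dV hdV dW hdW * (u : HA L e dV hdV dW hdW) * h)) νN :=
  hG_of_sections L e dV hdV dW hdW hdV0 hdW0 hχ (fun s => hstd.1.1 s) hcont νN

end Summit.HodgeConjecture.HodgeConjecture.Cruxes.HLiu418.K2LiuSiegelEisensteinKindWGlobalIntegrable

end
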